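import Summits.QuantumFields.YangMills.Theorems.SwapVirialDeficitSectorStiffnessCore
import Summits.QuantumFields.YangMills.Theorems.SwapVirialDeficitSectorLaplaceEndHubHubCot
import HarnessLib

/-!
# THE CORE STUB SPLITS ADDITIVELY INTO A TIP CORE AND AN END CORE (skeleton ➎ bookkeeping; LEAD sfw-p2 g99's ruling 2026-08-31 20:41Z on
# ⟨stmt-QuantumFields-24197⟩ `SwapVirialDeficit.SwapGluedStiffness`: «split 'stub_core_weight' additively into 'stub_core_tip' (region TipHub τ ×ˢ univ; RHS 1∕32·bulk)
# and 'stub_core_end' (region (EndHub τ ×ˢ univ) ∖ BTube L τ; RHS 1∕32·bulk) — TipHub∕EndHub are disjoint, so 'stub_core_weight' follows by add_le_add»)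

* §1 the B-tube family ✓`BTube` (✓Defs §7): `measurableSet_BTube`, `BTube_subset_endHub_prod`, `BTube_subset` (over the tip ∪ end hubs);
* §2 the core region is the DISJOINT union of the tip core and the end core: `core_region_eq_union`, `disjoint_tipCore_endCore`, `measurableSet_endCore`,
  `setIntegral_core_eq_add` (per sign pattern, any `b ≥ 0`);
* §3 ★★ `core_weight_of_tip_end` — the two stubs with weight `1∕32` each (same quantifier shape: `∃ K k τ₀, ∀ L τ ≤ τ₀∕L^k, ∀ b ≥ K·L^k·τ^{−k}`) ⟹ LITERALLY the
  skeleton stub `stub_core_weight` (weight `1∕16`); thresholds merged by `K₁ + K₂`, `max k₁ k₂`, `min τ₁ τ₂`.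
* §4 (appended) THE SAME FOR AN ARBITRARY TUBE FAMILY `BT L τ ⊆ EndHub τ × fibre` (the capped tubes ✓`BTubeCap` of LEAD g99's ruling 20:48Z, or any re-cut):
  `core_region_eq_union_of_subset`, `disjoint_tipCore_endDiff`, `setIntegral_core_eq_add_of_subset`, ★★ `core_weight_of_tip_end_family (BT) (hBTm) (hBTend) (htip) (hend)`.
* §5 (appended, assembler fcl-p3 g48; skeleton ➎ v9) THE CAPPED TUBES ✓`BTubeCap L τ X₁` AND LEAD g99's memo10 RULING «prove 'stub_core_end' on the LARGER region
  EndHub τ ×ˢ univ»: `BTubeCap_subset_endHub_prod`, `BTubeCap_subset` (general cap `X₁`), ★ `core_end_diff_of_endHub (BT) (hend)` (the end-core stub on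
  `(EndHub τ ×ˢ univ) ∖ BT L τ` for ANY family `BT` from the same stub on `EndHub τ ×ˢ univ`, by ✓`setIntegral_endCore_le_endHub`), ★★ `core_weight_of_tip_endHub_family`
  (`stub_core_weight` for any measurable `BT ⊆ End × fibre` from `stub_core_tip` and the end stub on `EndHub τ ×ˢ univ`).
HONEST LABEL: bookkeeping; the tip core (w2 + the ✓ZeroModeSigma tip share) and the end core (w3-successor + w2, memo8 Σ-ball) are OPEN, as are (S-B), the 001 stubs,
⟨24197⟩ ∕ ⟨24194⟩ and every rung; the Yang–Mills mass gap is NOT proved; no summit is proved by a line.  Seat ym-line-fcl-p3 g47 (cell ym-idea-1, free hands ➎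
assembler; item of record ⟨24085⟩ aside, untouched), `--supports stmt-QuantumFields-24197`.  THEOREMS ONLY (0 `def`, 0 `sorry`), standard axioms.
References: [cite: Luscher1983, §2]; [folklore].
-/

set_option autoImplicit false
set_option synthInstance.maxSize 1024

noncomputable section

open MeasureTheory Quaternion Set
open scoped Quaternion BigOperators ENNReal
open Literature.MathematicalPhysics.QuantumLattice
open Literature.MathematicalPhysics.QuantumFieldTheory hiding SU2
open Summit.QuantumFields.YangMills.Theorems.SwapTwistDeficit.ToronLog

attribute [local instance] Literature.Analysis.FluidPDE.Tao2016.quatMeasurableSpace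
  Literature.Analysis.FluidPDE.Tao2016.quatBorelSpace
  Literature.MathematicalPhysics.QuantumLattice.secondCountableTopology_su2

namespace Summit.QuantumFields.YangMills.Theorems.SwapVirialDeficit.SectorLaplace

open Summit.QuantumFields.YangMills.Theorems.FemtoTransferGap
open Summit.QuantumFields.YangMills.Theorems.FemtoTransferGap.TT
open Summit.QuantumFields.YangMills.Theorems.VirialFluxGap.RingDeficit
open Summit.QuantumFields.YangMills.Theorems.SwapVirialDeficit.SwapRing
open Summit.QuantumFields.YangMills.Theorems.SwapVirialDeficit.BlowUpRing

variable {L : ℕ} [NeZero L]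

/-! ## §1 The B-tube family -/

omit [NeZero L] in
/-- The B-tubes ✓`BTube L τ` are measurable. [folklore] -/
theorem measurableSet_BTube (L : ℕ) (τ : ℝ) : MeasurableSet (BTube L τ) := by
  have h1 : MeasurableSet {x : ℍ × GnoCoord L | x.1 ∈ EndHub τ} := measurable_fst (measurableSet_endHub τ)
  have h2 : MeasurableSet {x : ℍ × GnoCoord L | |x.1.re| < τ * ‖x.1‖} :=
    measurableSet_lt ((Quaternion.continuous_re.measurable.comp measurable_fst).abs) ((measurable_fst.norm).const_mul τ)
  have hx : ∀ i : Fin 3, Measurable fun x : ℍ × GnoCoord L => x.2.1.1 i :=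
    fun i => (measurable_pi_apply i).comp (measurable_fst.comp (measurable_fst.comp measurable_snd))
  have h3 : MeasurableSet {x : ℍ × GnoCoord L | τ ≤ Real.sqrt ((x.2.1.1 1) ^ 2 + (x.2.1.1 2) ^ 2)} :=
    measurableSet_le measurable_const ((((hx 1).pow_const 2).add ((hx 2).pow_const 2)).sqrt)
  have e : BTube L τ = {x : ℍ × GnoCoord L | x.1 ∈ EndHub τ} ∩ ({x : ℍ × GnoCoord L | |x.1.re| < τ * ‖x.1‖} ∩
      {x : ℍ × GnoCoord L | τ ≤ Real.sqrt ((x.2.1.1 1) ^ 2 + (x.2.1.1 2) ^ 2)}) := by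
    ext x; simp only [BTube, Set.mem_setOf_eq, Set.mem_inter_iff]
  rw [e]; exact h1.inter (h2.inter h3)

/-- The B-tubes sit over the END hubs. [folklore] -/
theorem BTube_subset_endHub_prod (L : ℕ) [NeZero L] (τ : ℝ) : BTube L τ ⊆ EndHub τ ×ˢ (univ : Set (GnoCoord L)) :=
  fun _ hx => Set.mk_mem_prod hx.1 (Set.mem_univ _)

/-- The B-tubes sit over the tip ∪ end hubs (the hypothesis `hBTsub` of ✓`h000_of_core_stubs`). [folklore] -/
theorem BTube_subset (L : ℕ) [NeZero L] (τ : ℝ) : BTube L τ ⊆ (TipHub τ ∪ EndHub τ) ×ˢ (univ : Set (GnoCoord L)) :=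
  fun _ hx => Set.mk_mem_prod (Or.inr hx.1) (Set.mem_univ _)

/-! ## §2 The core region is the disjoint union of the tip core and the end core -/

/-- `((Tip ∪ End) × fibre) ∖ B = (Tip × fibre) ∪ ((End × fibre) ∖ B)` (the tubes sit over the end hubs, the tip and end hubs are disjoint). [folklore] -/
theorem core_region_eq_union (L : ℕ) [NeZero L] (τ : ℝ) :
    ((TipHub τ ∪ EndHub τ) ×ˢ (univ : Set (GnoCoord L))) \ BTube L τ =
      (TipHub τ ×ˢ (univ : Set (GnoCoord L))) ∪ ((EndHub τ ×ˢ (univ : Set (GnoCoord L))) \ BTube L τ) := by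
  ext x
  have hdis : x.1 ∈ TipHub τ → x.1 ∉ EndHub τ := fun ht he => Set.disjoint_left.1 (disjoint_tipHub_endHub τ) ht he
  have hB : x ∈ BTube L τ → x.1 ∈ EndHub τ := fun hx => hx.1
  simp only [Set.mem_sdiff, Set.mem_prod, Set.mem_union, Set.mem_univ, and_true]
  constructor
  · rintro ⟨ht | he, hnB⟩
    · exact Or.inl ht
    · exact Or.inr ⟨he, hnB⟩
  · rintro (ht | ⟨he, hnB⟩)
    · exact ⟨Or.inl ht, fun hxB => hdis ht (hB hxB)⟩
    · exact ⟨Or.inr he, hnB⟩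

/-- The tip core and the end core are disjoint. [folklore] -/
theorem disjoint_tipCore_endCore (L : ℕ) [NeZero L] (τ : ℝ) :
    Disjoint (TipHub τ ×ˢ (univ : Set (GnoCoord L))) ((EndHub τ ×ˢ (univ : Set (GnoCoord L))) \ BTube L τ) := by
  refine Set.disjoint_left.2 fun x hxT hxE => ?_
  exact Set.disjoint_left.1 (disjoint_tipHub_endHub τ) (Set.mem_prod.1 hxT).1 (Set.mem_prod.1 hxE.1).1

omit [NeZero L] in
/-- The end core is measurable. [folklore] -/
theorem measurableSet_endCore (L : ℕ) [NeZero L] (τ : ℝ) : MeasurableSet ((EndHub τ ×ˢ (univ : Set (GnoCoord L))) \ BTube L τ) :=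
  ((measurableSet_endHub τ).prod MeasurableSet.univ).diff (measurableSet_BTube L τ)

/-- ★ Per sign pattern and `b ≥ 0`: `∫_core e^{−bF̂} = ∫_{tip core} e^{−bF̂} + ∫_{end core} e^{−bF̂}` (bounded integrand on a finite measure). [folklore] -/
theorem setIntegral_core_eq_add (τ : ℝ) (ε : GnoSign L) {b : ℝ} (hb : 0 ≤ b) :
    ∫ x in ((TipHub τ ∪ EndHub τ) ×ˢ (univ : Set (GnoCoord L))) \ BTube L τ, Real.exp (-(b * gnoDeficit z₀ (fun _ => 1) x.1 ε x.2)) ∂chartMeasure L =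
      (∫ x in TipHub τ ×ˢ (univ : Set (GnoCoord L)), Real.exp (-(b * gnoDeficit z₀ (fun _ => 1) x.1 ε x.2)) ∂chartMeasure L) +
        ∫ x in (EndHub τ ×ˢ (univ : Set (GnoCoord L))) \ BTube L τ, Real.exp (-(b * gnoDeficit z₀ (fun _ => 1) x.1 ε x.2)) ∂chartMeasure L := by
  have hF : Measurable fun x : ℍ × GnoCoord L => gnoDeficit z₀ (fun _ => 1) x.1 ε x.2 := measurable_gnoDeficit_uncurry z₀ (fun _ => 1) ε
  have hint : Integrable (fun x : ℍ × GnoCoord L => Real.exp (-(b * gnoDeficit z₀ (fun _ => 1) x.1 ε x.2))) (chartMeasure L) :=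
    integrable_chartMeasure_of_bounded ((hF.const_mul b).neg.exp) (M := 1) fun x => by
      rw [abs_of_pos (Real.exp_pos _)]
      exact Real.exp_le_one_iff.2 (by have := gnoDeficit_nonneg z₀ (fun _ => (1 : SU2)) x.1 ε x.2; nlinarith)
  rw [core_region_eq_union L τ, setIntegral_union (disjoint_tipCore_endCore L τ) (measurableSet_endCore L τ) hint.integrableOn hint.integrableOn]

/-! ## §3 The core stub from the tip core and the end core -/

set_option maxHeartbeats 400000 in
/-- ★★ **`stub_core_weight` FROM `stub_core_tip` AND `stub_core_end`** (LEAD g99 20:41Z): if above thresholds of the common shape the tip core weighs at most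
`1∕32` of the good bulk mass and the end core at most `1∕32`, then the whole core weighs at most `1∕16` — LITERALLY the skeleton stub `stub_core_weight`. [folklore] -/
theorem core_weight_of_tip_end
    (htip : ∃ K : ℝ, 0 < K ∧ ∃ k : ℕ, ∃ τ₀ : ℝ, 0 < τ₀ ∧ τ₀ ≤ 1 / 2 ∧ ∀ (L : ℕ) [NeZero L] (τ : ℝ), 0 < τ → τ ≤ τ₀ / (L : ℝ) ^ k →
      ∀ b : ℝ, K * (L : ℝ) ^ k * τ⁻¹ ^ k ≤ b →
        stiffKappa L (1 / 8) * ∑ ε ∈ (Finset.univ.filter fun ε : GnoSign L => GoodSign ε),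
            ∫ x in TipHub τ ×ˢ (univ : Set (GnoCoord L)), Real.exp (-(b * gnoDeficit z₀ (fun _ => 1) x.1 ε x.2)) ∂chartMeasure L ≤
          (1 / 32 : ℝ) * ∑ ε ∈ (Finset.univ.filter fun ε : GnoSign L => GoodSign ε), ∫ a in HubBulk τ, hubIntegral a ε b ∂coneMeasure)
    (hend : ∃ K : ℝ, 0 < K ∧ ∃ k : ℕ, ∃ τ₀ : ℝ, 0 < τ₀ ∧ τ₀ ≤ 1 / 2 ∧ ∀ (L : ℕ) [NeZero L] (τ : ℝ), 0 < τ → τ ≤ τ₀ / (L : ℝ) ^ k →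
      ∀ b : ℝ, K * (L : ℝ) ^ k * τ⁻¹ ^ k ≤ b →
        stiffKappa L (1 / 8) * ∑ ε ∈ (Finset.univ.filter fun ε : GnoSign L => GoodSign ε),
            ∫ x in (EndHub τ ×ˢ (univ : Set (GnoCoord L))) \ BTube L τ, Real.exp (-(b * gnoDeficit z₀ (fun _ => 1) x.1 ε x.2)) ∂chartMeasure L ≤
          (1 / 32 : ℝ) * ∑ ε ∈ (Finset.univ.filter fun ε : GnoSign L => GoodSign ε), ∫ a in HubBulk τ, hubIntegral a ε b ∂coneMeasure) :
    ∃ K : ℝ, 0 < K ∧ ∃ k : ℕ, ∃ τ₀ : ℝ, 0 < τ₀ ∧ τ₀ ≤ 1 / 2 ∧ ∀ (L : ℕ) [NeZero L] (τ : ℝ), 0 < τ → τ ≤ τ₀ / (L : ℝ) ^ k →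
      ∀ b : ℝ, K * (L : ℝ) ^ k * τ⁻¹ ^ k ≤ b →
        stiffKappa L (1 / 8) * ∑ ε ∈ (Finset.univ.filter fun ε : GnoSign L => GoodSign ε),
            ∫ x in ((TipHub τ ∪ EndHub τ) ×ˢ (univ : Set (GnoCoord L))) \ BTube L τ, Real.exp (-(b * gnoDeficit z₀ (fun _ => 1) x.1 ε x.2)) ∂chartMeasure L ≤
          (1 / 16 : ℝ) * ∑ ε ∈ (Finset.univ.filter fun ε : GnoSign L => GoodSign ε), ∫ a in HubBulk τ, hubIntegral a ε b ∂coneMeasure := by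
  obtain ⟨K₁, hK₁, k₁, τ₁, hτ₁, hτ₁h, h₁⟩ := htip
  obtain ⟨K₂, hK₂, k₂, τ₂, hτ₂, hτ₂h, h₂⟩ := hend
  refine ⟨K₁ + K₂, by positivity, max k₁ k₂, min τ₁ τ₂, lt_min hτ₁ hτ₂, (min_le_left _ _).trans hτ₁h, fun L _ τ hτ hτle b hb => ?_⟩
  have hL1 : (1 : ℝ) ≤ L := by exact_mod_cast NeZero.one_le
  have hLk : (1 : ℝ) ≤ (L : ℝ) ^ max k₁ k₂ := one_le_pow₀ hL1
  -- `τ ≤ 1∕2`, so `τ⁻¹ ≥ 1`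
  have hτ1 : τ ≤ 1 / 2 := by
    have h : min τ₁ τ₂ / (L : ℝ) ^ max k₁ k₂ ≤ min τ₁ τ₂ := div_le_self (lt_min hτ₁ hτ₂).le hLk
    exact hτle.trans (h.trans ((min_le_left _ _).trans hτ₁h))
  have hτi1 : 1 ≤ τ⁻¹ := by rw [one_le_inv₀ hτ]; linarith
  -- the two thresholds
  have hτle₁ : τ ≤ τ₁ / (L : ℝ) ^ k₁ :=
    hτle.trans (div_le_div₀ hτ₁.le (min_le_left _ _) (by positivity) (pow_le_pow_right₀ hL1 (le_max_left _ _)))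
  have hτle₂ : τ ≤ τ₂ / (L : ℝ) ^ k₂ :=
    hτle.trans (div_le_div₀ hτ₂.le (min_le_right _ _) (by positivity) (pow_le_pow_right₀ hL1 (le_max_right _ _)))
  have hmono : ∀ {K' : ℝ} {k' : ℕ}, 0 < K' → K' ≤ K₁ + K₂ → k' ≤ max k₁ k₂ → K' * (L : ℝ) ^ k' * τ⁻¹ ^ k' ≤ b := by
    intro K' k' hK' hK'le hk'
    have h1 : τ⁻¹ ^ k' ≤ τ⁻¹ ^ max k₁ k₂ := pow_le_pow_right₀ hτi1 hk'
    have h3 : (L : ℝ) ^ k' ≤ (L : ℝ) ^ max k₁ k₂ := pow_le_pow_right₀ hL1 hk'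
    calc K' * (L : ℝ) ^ k' * τ⁻¹ ^ k' ≤ (K₁ + K₂) * (L : ℝ) ^ max k₁ k₂ * τ⁻¹ ^ max k₁ k₂ :=
          mul_le_mul (mul_le_mul hK'le h3 (by positivity) (by positivity)) h1 (by positivity) (by positivity)
      _ ≤ b := hb
  have hb₁ : K₁ * (L : ℝ) ^ k₁ * τ⁻¹ ^ k₁ ≤ b := hmono hK₁ (by linarith) (le_max_left _ _)
  have hb₂ : K₂ * (L : ℝ) ^ k₂ * τ⁻¹ ^ k₂ ≤ b := hmono hK₂ (by linarith) (le_max_right _ _)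
  have hb0 : 0 ≤ b := le_trans (by positivity) hb₁
  have ht := h₁ L τ hτ hτle₁ b hb₁
  have he := h₂ L τ hτ hτle₂ b hb₂
  -- split the core integrals per sign pattern
  have hsplit : ∑ ε ∈ (Finset.univ.filter fun ε : GnoSign L => GoodSign ε),
      ∫ x in ((TipHub τ ∪ EndHub τ) ×ˢ (univ : Set (GnoCoord L))) \ BTube L τ, Real.exp (-(b * gnoDeficit z₀ (fun _ => 1) x.1 ε x.2)) ∂chartMeasure L =
      (∑ ε ∈ (Finset.univ.filter fun ε : GnoSign L => GoodSign ε),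
          ∫ x in TipHub τ ×ˢ (univ : Set (GnoCoord L)), Real.exp (-(b * gnoDeficit z₀ (fun _ => 1) x.1 ε x.2)) ∂chartMeasure L) +
        ∑ ε ∈ (Finset.univ.filter fun ε : GnoSign L => GoodSign ε),
          ∫ x in (EndHub τ ×ˢ (univ : Set (GnoCoord L))) \ BTube L τ, Real.exp (-(b * gnoDeficit z₀ (fun _ => 1) x.1 ε x.2)) ∂chartMeasure L := by
    rw [← Finset.sum_add_distrib]
    exact Finset.sum_congr rfl fun ε _ => setIntegral_core_eq_add τ ε hb0
  rw [hsplit, mul_add]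
  linarith

/-! ## §4 The same for an arbitrary tube family over the end hubs (capped tubes, re-cuts) -/

omit [NeZero L] in
/-- For ANY `T ⊆ End × fibre`: `((Tip ∪ End) × fibre) ∖ T = (Tip × fibre) ∪ ((End × fibre) ∖ T)`. [folklore] -/
theorem core_region_eq_union_of_subset (τ : ℝ) {T : Set (ℍ × GnoCoord L)} (hT : T ⊆ EndHub τ ×ˢ (univ : Set (GnoCoord L))) :
    ((TipHub τ ∪ EndHub τ) ×ˢ (univ : Set (GnoCoord L))) \ T =
      (TipHub τ ×ˢ (univ : Set (GnoCoord L))) ∪ ((EndHub τ ×ˢ (univ : Set (GnoCoord L))) \ T) := by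
  ext x
  have hdis : x.1 ∈ TipHub τ → x.1 ∉ EndHub τ := fun ht he => Set.disjoint_left.1 (disjoint_tipHub_endHub τ) ht he
  have hB : x ∈ T → x.1 ∈ EndHub τ := fun hx => (Set.mem_prod.1 (hT hx)).1
  simp only [Set.mem_sdiff, Set.mem_prod, Set.mem_union, Set.mem_univ, and_true]
  constructor
  · rintro ⟨ht | he, hnB⟩
    · exact Or.inl ht
    · exact Or.inr ⟨he, hnB⟩
  · rintro (ht | ⟨he, hnB⟩)
    · exact ⟨Or.inl ht, fun hxB => hdis ht (hB hxB)⟩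
    · exact ⟨Or.inr he, hnB⟩

omit [NeZero L] in
/-- The tip core is disjoint from every subset of `End × fibre`. [folklore] -/
theorem disjoint_tipCore_endDiff (τ : ℝ) (T : Set (ℍ × GnoCoord L)) :
    Disjoint (TipHub τ ×ˢ (univ : Set (GnoCoord L))) ((EndHub τ ×ˢ (univ : Set (GnoCoord L))) \ T) := by
  refine Set.disjoint_left.2 fun x hxT hxE => ?_
  exact Set.disjoint_left.1 (disjoint_tipHub_endHub τ) (Set.mem_prod.1 hxT).1 (Set.mem_prod.1 hxE.1).1

/-- ★ Per sign pattern and `b ≥ 0`, for any measurable `T ⊆ End × fibre`: `∫_{core(T)} e^{−bF̂} = ∫_{tip core} e^{−bF̂} + ∫_{(End × fibre) ∖ T} e^{−bF̂}`. [folklore] -/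
theorem setIntegral_core_eq_add_of_subset (τ : ℝ) (ε : GnoSign L) {b : ℝ} (hb : 0 ≤ b) {T : Set (ℍ × GnoCoord L)} (hTm : MeasurableSet T)
    (hT : T ⊆ EndHub τ ×ˢ (univ : Set (GnoCoord L))) :
    ∫ x in ((TipHub τ ∪ EndHub τ) ×ˢ (univ : Set (GnoCoord L))) \ T, Real.exp (-(b * gnoDeficit z₀ (fun _ => 1) x.1 ε x.2)) ∂chartMeasure L =
      (∫ x in TipHub τ ×ˢ (univ : Set (GnoCoord L)), Real.exp (-(b * gnoDeficit z₀ (fun _ => 1) x.1 ε x.2)) ∂chartMeasure L) +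
        ∫ x in (EndHub τ ×ˢ (univ : Set (GnoCoord L))) \ T, Real.exp (-(b * gnoDeficit z₀ (fun _ => 1) x.1 ε x.2)) ∂chartMeasure L := by
  have hF : Measurable fun x : ℍ × GnoCoord L => gnoDeficit z₀ (fun _ => 1) x.1 ε x.2 := measurable_gnoDeficit_uncurry z₀ (fun _ => 1) ε
  have hint : Integrable (fun x : ℍ × GnoCoord L => Real.exp (-(b * gnoDeficit z₀ (fun _ => 1) x.1 ε x.2))) (chartMeasure L) :=
    integrable_chartMeasure_of_bounded ((hF.const_mul b).neg.exp) (M := 1) fun x => by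
      rw [abs_of_pos (Real.exp_pos _)]
      exact Real.exp_le_one_iff.2 (by have := gnoDeficit_nonneg z₀ (fun _ => (1 : SU2)) x.1 ε x.2; nlinarith)
  rw [core_region_eq_union_of_subset τ hT, setIntegral_union (disjoint_tipCore_endDiff τ T)
    (((measurableSet_endHub τ).prod MeasurableSet.univ).diff hTm) hint.integrableOn hint.integrableOn]

set_option maxHeartbeats 400000 in
/-- ★★ **`stub_core_weight` FROM `stub_core_tip` AND `stub_core_end` FOR ANY TUBE FAMILY `BT L τ ⊆ EndHub τ × fibre`** (measurable): weights `1∕32 + 1∕32 = 1∕16`,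
thresholds merged as in `core_weight_of_tip_end` — the form the capped tubes ✓`BTubeCap L τ X₁` (LEAD g99 20:48Z) plug into. [folklore] -/
theorem core_weight_of_tip_end_family (BT : ∀ L : ℕ, ℝ → Set (ℍ × GnoCoord L)) (hBTm : ∀ (L : ℕ) (τ : ℝ), MeasurableSet (BT L τ))
    (hBTend : ∀ (L : ℕ) [NeZero L] (τ : ℝ), BT L τ ⊆ EndHub τ ×ˢ (univ : Set (GnoCoord L)))
    (htip : ∃ K : ℝ, 0 < K ∧ ∃ k : ℕ, ∃ τ₀ : ℝ, 0 < τ₀ ∧ τ₀ ≤ 1 / 2 ∧ ∀ (L : ℕ) [NeZero L] (τ : ℝ), 0 < τ → τ ≤ τ₀ / (L : ℝ) ^ k →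
      ∀ b : ℝ, K * (L : ℝ) ^ k * τ⁻¹ ^ k ≤ b →
        stiffKappa L (1 / 8) * ∑ ε ∈ (Finset.univ.filter fun ε : GnoSign L => GoodSign ε),
            ∫ x in TipHub τ ×ˢ (univ : Set (GnoCoord L)), Real.exp (-(b * gnoDeficit z₀ (fun _ => 1) x.1 ε x.2)) ∂chartMeasure L ≤
          (1 / 32 : ℝ) * ∑ ε ∈ (Finset.univ.filter fun ε : GnoSign L => GoodSign ε), ∫ a in HubBulk τ, hubIntegral a ε b ∂coneMeasure)
    (hend : ∃ K : ℝ, 0 < K ∧ ∃ k : ℕ, ∃ τ₀ : ℝ, 0 < τ₀ ∧ τ₀ ≤ 1 / 2 ∧ ∀ (L : ℕ) [NeZero L] (τ : ℝ), 0 < τ → τ ≤ τ₀ / (L : ℝ) ^ k →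
      ∀ b : ℝ, K * (L : ℝ) ^ k * τ⁻¹ ^ k ≤ b →
        stiffKappa L (1 / 8) * ∑ ε ∈ (Finset.univ.filter fun ε : GnoSign L => GoodSign ε),
            ∫ x in (EndHub τ ×ˢ (univ : Set (GnoCoord L))) \ BT L τ, Real.exp (-(b * gnoDeficit z₀ (fun _ => 1) x.1 ε x.2)) ∂chartMeasure L ≤
          (1 / 32 : ℝ) * ∑ ε ∈ (Finset.univ.filter fun ε : GnoSign L => GoodSign ε), ∫ a in HubBulk τ, hubIntegral a ε b ∂coneMeasure) :
    ∃ K : ℝ, 0 < K ∧ ∃ k : ℕ, ∃ τ₀ : ℝ, 0 < τ₀ ∧ τ₀ ≤ 1 / 2 ∧ ∀ (L : ℕ) [NeZero L] (τ : ℝ), 0 < τ → τ ≤ τ₀ / (L : ℝ) ^ k →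
      ∀ b : ℝ, K * (L : ℝ) ^ k * τ⁻¹ ^ k ≤ b →
        stiffKappa L (1 / 8) * ∑ ε ∈ (Finset.univ.filter fun ε : GnoSign L => GoodSign ε),
            ∫ x in ((TipHub τ ∪ EndHub τ) ×ˢ (univ : Set (GnoCoord L))) \ BT L τ, Real.exp (-(b * gnoDeficit z₀ (fun _ => 1) x.1 ε x.2)) ∂chartMeasure L ≤
          (1 / 16 : ℝ) * ∑ ε ∈ (Finset.univ.filter fun ε : GnoSign L => GoodSign ε), ∫ a in HubBulk τ, hubIntegral a ε b ∂coneMeasure := by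
  obtain ⟨K₁, hK₁, k₁, τ₁, hτ₁, hτ₁h, h₁⟩ := htip
  obtain ⟨K₂, hK₂, k₂, τ₂, hτ₂, hτ₂h, h₂⟩ := hend
  refine ⟨K₁ + K₂, by positivity, max k₁ k₂, min τ₁ τ₂, lt_min hτ₁ hτ₂, (min_le_left _ _).trans hτ₁h, fun L _ τ hτ hτle b hb => ?_⟩
  have hL1 : (1 : ℝ) ≤ L := by exact_mod_cast NeZero.one_le
  have hLk : (1 : ℝ) ≤ (L : ℝ) ^ max k₁ k₂ := one_le_pow₀ hL1
  have hτ1 : τ ≤ 1 / 2 := by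
    have h : min τ₁ τ₂ / (L : ℝ) ^ max k₁ k₂ ≤ min τ₁ τ₂ := div_le_self (lt_min hτ₁ hτ₂).le hLk
    exact hτle.trans (h.trans ((min_le_left _ _).trans hτ₁h))
  have hτi1 : 1 ≤ τ⁻¹ := by rw [one_le_inv₀ hτ]; linarith
  have hτle₁ : τ ≤ τ₁ / (L : ℝ) ^ k₁ :=
    hτle.trans (div_le_div₀ hτ₁.le (min_le_left _ _) (by positivity) (pow_le_pow_right₀ hL1 (le_max_left _ _)))
  have hτle₂ : τ ≤ τ₂ / (L : ℝ) ^ k₂ :=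
    hτle.trans (div_le_div₀ hτ₂.le (min_le_right _ _) (by positivity) (pow_le_pow_right₀ hL1 (le_max_right _ _)))
  have hmono : ∀ {K' : ℝ} {k' : ℕ}, 0 < K' → K' ≤ K₁ + K₂ → k' ≤ max k₁ k₂ → K' * (L : ℝ) ^ k' * τ⁻¹ ^ k' ≤ b := by
    intro K' k' hK' hK'le hk'
    have h1 : τ⁻¹ ^ k' ≤ τ⁻¹ ^ max k₁ k₂ := pow_le_pow_right₀ hτi1 hk'
    have h3 : (L : ℝ) ^ k' ≤ (L : ℝ) ^ max k₁ k₂ := pow_le_pow_right₀ hL1 hk'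
    calc K' * (L : ℝ) ^ k' * τ⁻¹ ^ k' ≤ (K₁ + K₂) * (L : ℝ) ^ max k₁ k₂ * τ⁻¹ ^ max k₁ k₂ :=
          mul_le_mul (mul_le_mul hK'le h3 (by positivity) (by positivity)) h1 (by positivity) (by positivity)
      _ ≤ b := hb
  have hb₁ : K₁ * (L : ℝ) ^ k₁ * τ⁻¹ ^ k₁ ≤ b := hmono hK₁ (by linarith) (le_max_left _ _)
  have hb₂ : K₂ * (L : ℝ) ^ k₂ * τ⁻¹ ^ k₂ ≤ b := hmono hK₂ (by linarith) (le_max_right _ _)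
  have hb0 : 0 ≤ b := le_trans (by positivity) hb₁
  have ht := h₁ L τ hτ hτle₁ b hb₁
  have he := h₂ L τ hτ hτle₂ b hb₂
  have hsplit : ∑ ε ∈ (Finset.univ.filter fun ε : GnoSign L => GoodSign ε),
      ∫ x in ((TipHub τ ∪ EndHub τ) ×ˢ (univ : Set (GnoCoord L))) \ BT L τ, Real.exp (-(b * gnoDeficit z₀ (fun _ => 1) x.1 ε x.2)) ∂chartMeasure L =
      (∑ ε ∈ (Finset.univ.filter fun ε : GnoSign L => GoodSign ε),
          ∫ x in TipHub τ ×ˢ (univ : Set (GnoCoord L)), Real.exp (-(b * gnoDeficit z₀ (fun _ => 1) x.1 ε x.2)) ∂chartMeasure L) +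
        ∑ ε ∈ (Finset.univ.filter fun ε : GnoSign L => GoodSign ε),
          ∫ x in (EndHub τ ×ˢ (univ : Set (GnoCoord L))) \ BT L τ, Real.exp (-(b * gnoDeficit z₀ (fun _ => 1) x.1 ε x.2)) ∂chartMeasure L := by
    rw [← Finset.sum_add_distrib]
    exact Finset.sum_congr rfl fun ε _ => setIntegral_core_eq_add_of_subset τ ε hb0 (hBTm L τ) (hBTend L τ)
  rw [hsplit, mul_add]
  linarith

/-! ## §5 The capped tubes and the end stub on the enlarged region `EndHub τ ×ˢ univ` (LEAD g99 memo10 ruling; skeleton ➎ v9) -/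

/-- The capped B-tubes ✓`BTubeCap L τ X₁` sit over the END hubs. [folklore] -/
theorem BTubeCap_subset_endHub_prod (L : ℕ) [NeZero L] (τ X₁ : ℝ) : BTubeCap L τ X₁ ⊆ EndHub τ ×ˢ (univ : Set (GnoCoord L)) :=
  (BTubeCap_subset_BTube L τ X₁).trans (BTube_subset_endHub_prod L τ)

/-- The capped B-tubes sit over the tip ∪ end hubs (the hypothesis `hBTsub` of ✓`h000_of_core_stubs`). [folklore] -/
theorem BTubeCap_subset (L : ℕ) [NeZero L] (τ X₁ : ℝ) : BTubeCap L τ X₁ ⊆ (TipHub τ ∪ EndHub τ) ×ˢ (univ : Set (GnoCoord L)) :=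
  (BTubeCap_subset_BTube L τ X₁).trans (BTube_subset L τ)

/-- ★ **THE END-CORE STUB ON `(EndHub τ ×ˢ univ) ∖ BT L τ` FROM THE END STUB ON THE ENLARGED REGION `EndHub τ ×ˢ univ`** (LEAD g99 memo10 ruling: the B-tubes are
`b^{−1∕2}`·poly-negligible relative to the bulk, so the end-core weight bound is proved with the tubes INCLUDED and the skeleton's shape follows by monotonicity,
✓`setIntegral_endCore_le_endHub`, integrand `≥ 0`), for ANY tube family `BT`, same thresholds. [folklore] -/
theorem core_end_diff_of_endHub (BT : ∀ L : ℕ, ℝ → Set (ℍ × GnoCoord L))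
    (hend : ∃ K : ℝ, 0 < K ∧ ∃ k : ℕ, ∃ τ₀ : ℝ, 0 < τ₀ ∧ τ₀ ≤ 1 / 2 ∧ ∀ (L : ℕ) [NeZero L] (τ : ℝ), 0 < τ → τ ≤ τ₀ / (L : ℝ) ^ k →
      ∀ b : ℝ, K * (L : ℝ) ^ k * τ⁻¹ ^ k ≤ b →
        stiffKappa L (1 / 8) * ∑ ε ∈ (Finset.univ.filter fun ε : GnoSign L => GoodSign ε),
            ∫ x in EndHub τ ×ˢ (univ : Set (GnoCoord L)), Real.exp (-(b * gnoDeficit z₀ (fun _ => 1) x.1 ε x.2)) ∂chartMeasure L ≤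
          (1 / 32 : ℝ) * ∑ ε ∈ (Finset.univ.filter fun ε : GnoSign L => GoodSign ε), ∫ a in HubBulk τ, hubIntegral a ε b ∂coneMeasure) :
    ∃ K : ℝ, 0 < K ∧ ∃ k : ℕ, ∃ τ₀ : ℝ, 0 < τ₀ ∧ τ₀ ≤ 1 / 2 ∧ ∀ (L : ℕ) [NeZero L] (τ : ℝ), 0 < τ → τ ≤ τ₀ / (L : ℝ) ^ k →
      ∀ b : ℝ, K * (L : ℝ) ^ k * τ⁻¹ ^ k ≤ b →
        stiffKappa L (1 / 8) * ∑ ε ∈ (Finset.univ.filter fun ε : GnoSign L => GoodSign ε),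
            ∫ x in (EndHub τ ×ˢ (univ : Set (GnoCoord L))) \ BT L τ, Real.exp (-(b * gnoDeficit z₀ (fun _ => 1) x.1 ε x.2)) ∂chartMeasure L ≤
          (1 / 32 : ℝ) * ∑ ε ∈ (Finset.univ.filter fun ε : GnoSign L => GoodSign ε), ∫ a in HubBulk τ, hubIntegral a ε b ∂coneMeasure := by
  obtain ⟨K, hK, k, τ₀, hτ₀, hτ₀h, h⟩ := hend
  refine ⟨K, hK, k, τ₀, hτ₀, hτ₀h, fun L _ τ hτ hτle b hb => ?_⟩
  have hb0 : 0 ≤ b := le_trans (by positivity) hb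
  have hκ : 0 ≤ stiffKappa L (1 / 8) := by
    have hL1 : (1 : ℝ) ≤ L := by exact_mod_cast NeZero.one_le
    have hL4 : (1 : ℝ) ≤ (L : ℝ) ^ 4 := one_le_pow₀ hL1
    unfold stiffKappa; linarith
  have hmono : ∑ ε ∈ (Finset.univ.filter fun ε : GnoSign L => GoodSign ε),
      ∫ x in (EndHub τ ×ˢ (univ : Set (GnoCoord L))) \ BT L τ, Real.exp (-(b * gnoDeficit z₀ (fun _ => 1) x.1 ε x.2)) ∂chartMeasure L ≤
      ∑ ε ∈ (Finset.univ.filter fun ε : GnoSign L => GoodSign ε),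
        ∫ x in EndHub τ ×ˢ (univ : Set (GnoCoord L)), Real.exp (-(b * gnoDeficit z₀ (fun _ => 1) x.1 ε x.2)) ∂chartMeasure L :=
    Finset.sum_le_sum fun ε _ => setIntegral_endCore_le_endHub z₀ (fun _ => 1) ε τ hb0 (BT L τ)
  exact (mul_le_mul_of_nonneg_left hmono hκ).trans (h L τ hτ hτle b hb)

/-- ★★ **`stub_core_weight` FOR ANY MEASURABLE TUBE FAMILY `BT L τ ⊆ EndHub τ × fibre` FROM `stub_core_tip` AND THE END STUB ON THE ENLARGED REGION `EndHub τ ×ˢ univ`**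
(skeleton ➎ v9: `core_weight_of_tip_end_family` ∘ `core_end_diff_of_endHub`). [folklore] -/
theorem core_weight_of_tip_endHub_family (BT : ∀ L : ℕ, ℝ → Set (ℍ × GnoCoord L)) (hBTm : ∀ (L : ℕ) (τ : ℝ), MeasurableSet (BT L τ))
    (hBTend : ∀ (L : ℕ) [NeZero L] (τ : ℝ), BT L τ ⊆ EndHub τ ×ˢ (univ : Set (GnoCoord L)))
    (htip : ∃ K : ℝ, 0 < K ∧ ∃ k : ℕ, ∃ τ₀ : ℝ, 0 < τ₀ ∧ τ₀ ≤ 1 / 2 ∧ ∀ (L : ℕ) [NeZero L] (τ : ℝ), 0 < τ → τ ≤ τ₀ / (L : ℝ) ^ k →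
      ∀ b : ℝ, K * (L : ℝ) ^ k * τ⁻¹ ^ k ≤ b →
        stiffKappa L (1 / 8) * ∑ ε ∈ (Finset.univ.filter fun ε : GnoSign L => GoodSign ε),
            ∫ x in TipHub τ ×ˢ (univ : Set (GnoCoord L)), Real.exp (-(b * gnoDeficit z₀ (fun _ => 1) x.1 ε x.2)) ∂chartMeasure L ≤
          (1 / 32 : ℝ) * ∑ ε ∈ (Finset.univ.filter fun ε : GnoSign L => GoodSign ε), ∫ a in HubBulk τ, hubIntegral a ε b ∂coneMeasure)
    (hend : ∃ K : ℝ, 0 < K ∧ ∃ k : ℕ, ∃ τ₀ : ℝ, 0 < τ₀ ∧ τ₀ ≤ 1 / 2 ∧ ∀ (L : ℕ) [NeZero L] (τ : ℝ), 0 < τ → τ ≤ τ₀ / (L : ℝ) ^ k →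
      ∀ b : ℝ, K * (L : ℝ) ^ k * τ⁻¹ ^ k ≤ b →
        stiffKappa L (1 / 8) * ∑ ε ∈ (Finset.univ.filter fun ε : GnoSign L => GoodSign ε),
            ∫ x in EndHub τ ×ˢ (univ : Set (GnoCoord L)), Real.exp (-(b * gnoDeficit z₀ (fun _ => 1) x.1 ε x.2)) ∂chartMeasure L ≤
          (1 / 32 : ℝ) * ∑ ε ∈ (Finset.univ.filter fun ε : GnoSign L => GoodSign ε), ∫ a in HubBulk τ, hubIntegral a ε b ∂coneMeasure) :
    ∃ K : ℝ, 0 < K ∧ ∃ k : ℕ, ∃ τ₀ : ℝ, 0 < τ₀ ∧ τ₀ ≤ 1 / 2 ∧ ∀ (L : ℕ) [NeZero L] (τ : ℝ), 0 < τ → τ ≤ τ₀ / (L : ℝ) ^ k →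
      ∀ b : ℝ, K * (L : ℝ) ^ k * τ⁻¹ ^ k ≤ b →
        stiffKappa L (1 / 8) * ∑ ε ∈ (Finset.univ.filter fun ε : GnoSign L => GoodSign ε),
            ∫ x in ((TipHub τ ∪ EndHub τ) ×ˢ (univ : Set (GnoCoord L))) \ BT L τ, Real.exp (-(b * gnoDeficit z₀ (fun _ => 1) x.1 ε x.2)) ∂chartMeasure L ≤
          (1 / 16 : ℝ) * ∑ ε ∈ (Finset.univ.filter fun ε : GnoSign L => GoodSign ε), ∫ a in HubBulk τ, hubIntegral a ε b ∂coneMeasure :=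
  core_weight_of_tip_end_family BT hBTm hBTend htip (core_end_diff_of_endHub BT hend)

end Summit.QuantumFields.YangMills.Theorems.SwapVirialDeficit.SectorLaplace

end
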